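import Summits.CriticalPhenomena.PercolationContinuityZ3.Theorems.PercNearOneGluingNoHeavyLowerTailQuantitativeBHKGlauber
import Summits.CriticalPhenomena.PercolationContinuityZ3.Theorems.PercNearOneGluingNoHeavyLowerTailQuantitativeBHKRepulsion
import Summits.CriticalPhenomena.PercolationContinuityZ3.Theorems.PercNearOneGluingNearOneGluingBhkLogSupermodular
import HarnessLib

/-!
# Quantitative two-cluster repulsion with the Glauber floor (BHK Thm 1.4 / eq. (2) made quantitative)

Support file (`--supports stmt-CriticalPhenomena-4575`), prover seat `prim-rate-mine-2` (lane prim-rate, constants-miner (c), BENCH row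
M2-R9; `run/shared/lean/prim/prim-rate/prim-rate-mine-2/CANDIDATES.md` §gen-2, PROOFS.md §P7/§P12).  No definitions, no named facts,
no sorries; standard axioms.

van den Berg–Häggström–Kahn's Theorem 1.4 / eq. (2): given `s ↮ t`, the clusters `C_s` and `C_t` are negatively correlated —
`−Cov_ν(F(C_s), 1{o ∈ C_t}) ≥ 0` for `F` increasing and `ν = μ(· | s ↮ t)`.  Their proof (display (10), p. 7) conditions on `C_s = W`:
then `1{t ↔ o}` has conditional expectation `R(W) = P(t ↔ o off the pairs meeting W)`, a DEcreasing function of `W`, and Thm 1.3 applies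
to `(F, −R)`.  Feeding the quantitative Thm 1.3 of this lane (`QuantBHK.condCov_ge_glauberTerm`, the Glauber floor, row M2-R8(a)) into the
same reduction gives the explicit floor

  `(∫_D F(C_s))·μ(D ∩ {t↔o}) − μ(D)·∫_{D∩{t↔o}} F(C_s) ≥ μ(D)·w_e(1−w_e)·∫ 1_D(ω∪e)·ΔF·(R(C_s(ω∖e)) − R(C_s(ω∪e))) dμ ≥ 0`

for every pair `e` (`QuantBHK.twoCluster_repulsion_ge_glauberTerm`), where `ΔF = F(C_s(ω∪e)) − F(C_s(ω∖e)) ≥ 0` and the second factor is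
`≥ 0` by `residual_antitone`; and the same for an arbitrary increasing `G(C_t)` in place of `1{o ∈ C_t}`, with
`Ψ_G(W) = ∫ G(C_t(η off the pairs meeting W)) dμ(η)` in place of `R` (`QuantBHK.twoCluster_negCov_ge_glauberTerm`, BHK Thm 1.4 made
quantitative).  The display-(10) steps are `setIntegral_mul_ind_openConn_eq_residual` / `setIntegral_mul_clusterFn_eq_condexp` (from the
tree's `BHK2006.sum_cond_cluster`).
[cite: VandenbergHaggstromKahn2005, Thm. 1.3 (p. 6), Thm. 1.4 and display (10) (p. 7)]
-/

noncomputable section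

open MeasureTheory Set Literature.Probability.LatticeModels
open Literature.Probability.LatticeModels (prodBernoulli)

namespace Summit.CriticalPhenomena.PercolationContinuityZ3.Theorems

namespace QuantBHK

open Literature.Probability.Percolation Literature.Probability.Percolation.BHK2006
open scoped Classical
open DecisionTree (ind ind_of_mem ind_of_not_mem ind_nonneg)

variable {V : Type*} [Fintype V]

/-- **BHK's display (10) for the connection indicator**: on `D = {s ↮ t}`, conditioning on `C_s` turns `1{t ↔ o}` into the
residual connection probability `R(C_s) = P(t ↔ o off the pairs meeting C_s)`:
`∫_D F(C_s)·1{t↔o} dμ = ∫_D F(C_s)·R(C_s) dμ`. [cite: VandenbergHaggstromKahn2005, display (10) (p. 7)] -/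
theorem setIntegral_mul_ind_openConn_eq_residual (w : Sym2 V → unitInterval) (s t o : V) (F : Set V → ℝ) :
    ∫ ω in {ω : BondConfig V | ¬ (openGraph ω).Reachable s t},
        F (openCluster ω s) * (openConn t o).indicator (fun _ => (1 : ℝ)) ω ∂(prodBernoulli w) =
      ∫ ω in {ω : BondConfig V | ¬ (openGraph ω).Reachable s t},
        F (openCluster ω s) *
          (prodBernoulli w).real {η : BondConfig V |
            (openGraph (η \ {f | ∃ u ∈ openCluster ω s, u ∈ f})).Reachable t o} ∂(prodBernoulli w) := by
  set w' : Sym2 V → ℝ := fun f => (w f : ℝ) with hw'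
  have hm : ∑ ω, weight w' ω = 1 := by
    have h1 := integral_prodBernoulli_eq_sum w fun _ => (1 : ℝ)
    simp only [integral_const, probReal_univ, smul_eq_mul, mul_one] at h1
    exact h1.symm
  set vs : Set (Sym2 V) → Set V := fun C => {a : V | a = s ∨ ∃ e' ∈ C, a ∈ e'} with hvs
  have hvsC : ∀ ζ : BondConfig V, vs (openEdgeCluster ζ s) = openCluster ζ s := fun ζ => by
    rw [KNPreFKG.openCluster_eq_setOf_openEdgeCluster]
  set T : Set (Set (Sym2 V)) := {C | o = t ∨ ∃ f ∈ C, o ∈ f} with hT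
  have hTC : ∀ ζ : BondConfig V, ind T (openEdgeCluster ζ t) = ind (openConn t o) ζ := by
    intro ζ
    by_cases h : (openGraph ζ).Reachable t o
    · rw [ind_of_mem (show ζ ∈ openConn t o from h), ind_of_mem]
      exact (reachable_iff_exists_mem_openEdgeCluster ζ t o).1 h
    · rw [ind_of_not_mem (show ζ ∉ openConn t o from h), ind_of_not_mem]
      exact fun h' => h ((reachable_iff_exists_mem_openEdgeCluster ζ t o).2 h')
  set H : Set (Sym2 V) → Set (Sym2 V) → ℝ := fun Cs Ct => F (vs Cs) * ind T Ct with hH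
  have key := sum_cond_cluster w' hm s t H (D := {ω : Set (Sym2 V) | ¬ (openGraph ω).Reachable s t}) fun ω => Iff.rfl
  have hA : ∀ ω : BondConfig V, {e : Sym2 V | ∃ v ∈ e, v = s ∨ ∃ e' ∈ openEdgeCluster ω s, v ∈ e'} =
      {f | ∃ u ∈ openCluster ω s, u ∈ f} := by
    intro ω
    ext f
    rw [← hvsC]
    simp only [hvs, Set.mem_setOf_eq]
    constructor
    · rintro ⟨v, hv, h⟩; exact ⟨v, h, hv⟩
    · rintro ⟨u, h, hu⟩; exact ⟨u, hu, h⟩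
  rw [setIntegral_eq_sum_weight, setIntegral_eq_sum_weight]
  have hl : ∀ ω : BondConfig V, F (openCluster ω s) * (openConn t o).indicator (fun _ => (1 : ℝ)) ω =
      H (openEdgeCluster ω s) (openEdgeCluster ω t) := by
    intro ω
    simp only [hH, hvsC, hTC]
    by_cases h : ω ∈ openConn t o
    · rw [Set.indicator_of_mem h, ind_of_mem h]
    · rw [Set.indicator_of_notMem h, ind_of_not_mem h]
  have hr : ∀ ω : BondConfig V,
      F (openCluster ω s) * (prodBernoulli w).real {η : BondConfig V |
          (openGraph (η \ {f | ∃ u ∈ openCluster ω s, u ∈ f})).Reachable t o} =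
        ∑ η, weight w' η * H (openEdgeCluster ω s)
          (openEdgeCluster (η \ {e | ∃ v ∈ e, v = s ∨ ∃ e' ∈ openEdgeCluster ω s, v ∈ e'}) t) := by
    intro ω
    rw [hA ω, prodBernoulli_real_eq_sum_weight_ind, Finset.mul_sum]
    refine Finset.sum_congr rfl fun η _ => ?_
    simp only [hH, hvsC, hTC]
    have : ind (openConn t o) (η \ {f | ∃ u ∈ openCluster ω s, u ∈ f}) =
        ind {η : BondConfig V | (openGraph (η \ {f | ∃ u ∈ openCluster ω s, u ∈ f})).Reachable t o} η := by
      by_cases h : η ∈ {η' : BondConfig V | (openGraph (η' \ {f | ∃ u ∈ openCluster ω s, u ∈ f})).Reachable t o}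
      · rw [ind_of_mem h, ind_of_mem (show η \ {f | ∃ u ∈ openCluster ω s, u ∈ f} ∈ openConn t o from h)]
      · rw [ind_of_not_mem h, ind_of_not_mem (show η \ {f | ∃ u ∈ openCluster ω s, u ∈ f} ∉ openConn t o from h)]
    rw [this]; ring
  simp_rw [hl, hr]
  exact key

omit [Fintype V] in
/-- The residual connection probability is antitone in the removed vertex set: closing more pairs can only disconnect. [folklore] -/
theorem residual_antitone (w : Sym2 V → unitInterval) (t o : V) :
    Antitone fun W : Set V =>
      (prodBernoulli w).real {η : BondConfig V | (openGraph (η \ {f | ∃ u ∈ W, u ∈ f})).Reachable t o} := by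
  intro W W' hWW'
  refine measureReal_mono (fun η hη => ?_)
  simp only [Set.mem_setOf_eq] at hη ⊢
  refine hη.mono (openGraph_le (Set.sdiff_subset_sdiff_right ?_))
  rintro f ⟨u, hu, huf⟩
  exact ⟨u, hWW' hu, huf⟩

/-- **Row M2-R9: quantitative two-cluster repulsion (BHK Thm 1.4 / eq. (2)) with the Glauber floor.**  `D = {s ↮ t}`, `F`
increasing, `R(W) = P(t ↔ o off the pairs meeting W)` (so `E[1{t↔o} | C_s = W] = R(W)` on `D`, BHK's display (10)), `e` any pair:
  `μ(D)·w_e(1−w_e)·∫ 1_D(ω∪e)·(F(C_s(ω∪e)) − F(C_s(ω∖e)))·(R(C_s(ω∖e)) − R(C_s(ω∪e))) dμ`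
  `≤ (∫_D F(C_s))·μ(D ∩ {t↔o}) − μ(D)·∫_{D∩{t↔o}} F(C_s)`,
i.e. `−Cov_ν(F(C_s), 1{o ∈ C_t}) ≥ E_ν[Cov_ν(F(C_s), −R(C_s) | ω off e)] ≥ 0` for `ν = μ(·|s↮t)` — BHK's (2)/Thm 1.4 is the
statement with `0` on the left.  Proof: display (10) + the Glauber floor for `(F, −R)` (`condCov_ge_glauberTerm`).
[cite: VandenbergHaggstromKahn2005, Thm. 1.3 (p. 6), Thm. 1.4 and display (10) (p. 7)] -/
theorem twoCluster_repulsion_ge_glauberTerm (w : Sym2 V → unitInterval) (s t o : V) (e : Sym2 V) (F : Set V → ℝ)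
    (hF : Monotone F) :
    (prodBernoulli w).real {ω : BondConfig V | ¬ (openGraph ω).Reachable s t} *
        ((w e : ℝ) * (1 - w e) *
          ∫ ω, ({ω : BondConfig V | ¬ (openGraph ω).Reachable s t}).indicator (fun _ => (1 : ℝ)) (insert e ω) *
            ((F (openCluster (insert e ω) s) - F (openCluster (ω \ {e}) s)) *
              ((prodBernoulli w).real {η : BondConfig V |
                  (openGraph (η \ {f | ∃ u ∈ openCluster (ω \ {e}) s, u ∈ f})).Reachable t o} -
                (prodBernoulli w).real {η : BondConfig V |
                  (openGraph (η \ {f | ∃ u ∈ openCluster (insert e ω) s, u ∈ f})).Reachable t o})) ∂(prodBernoulli w)) ≤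
      (∫ ω in {ω : BondConfig V | ¬ (openGraph ω).Reachable s t}, F (openCluster ω s) ∂(prodBernoulli w)) *
          (prodBernoulli w).real ({ω : BondConfig V | ¬ (openGraph ω).Reachable s t} ∩ openConn t o) -
        (prodBernoulli w).real {ω : BondConfig V | ¬ (openGraph ω).Reachable s t} *
          ∫ ω in {ω : BondConfig V | ¬ (openGraph ω).Reachable s t} ∩ openConn t o,
            F (openCluster ω s) ∂(prodBernoulli w) := by
  set μ := prodBernoulli w with hμ
  set R : Set V → ℝ := fun W =>
    μ.real {η : BondConfig V | (openGraph (η \ {f | ∃ u ∈ W, u ∈ f})).Reachable t o} with hR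
  have hRa : Antitone R := residual_antitone w t o
  have hG : Monotone fun W => - R W := fun W W' h => neg_le_neg (hRa h)
  have key := condCov_ge_glauberTerm w s {t} e F (fun W => - R W) hF hG
  have hDt : {ω : BondConfig V | ∀ x ∈ ({t} : Set V), ¬ (openGraph ω).Reachable s x} =
      {ω : BondConfig V | ¬ (openGraph ω).Reachable s t} := by
    ext ω; simp
  rw [hDt] at key
  set D : Set (BondConfig V) := {ω : BondConfig V | ¬ (openGraph ω).Reachable s t} with hD
  have hDm : MeasurableSet D := MeasurableSet.of_discrete
  have hCm : MeasurableSet (openConn t o : Set (BondConfig V)) := MeasurableSet.of_discrete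
  -- display (10): the two `R`-integrals are connection integrals
  have h10 := setIntegral_mul_ind_openConn_eq_residual w s t o F
  have h10' := setIntegral_mul_ind_openConn_eq_residual w s t o fun _ => (1 : ℝ)
  simp only [one_mul] at h10'
  have i1 : ∫ ω in D, F (openCluster ω s) * (fun W => - R W) (openCluster ω s) ∂μ =
      - ∫ ω in D ∩ openConn t o, F (openCluster ω s) ∂μ := by
    have : ∫ ω in D ∩ openConn t o, F (openCluster ω s) ∂μ =
        ∫ ω in D, F (openCluster ω s) * (openConn t o).indicator (fun _ => (1 : ℝ)) ω ∂μ := by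
      rw [Set.inter_comm, ← Measure.restrict_restrict hCm, ← integral_indicator hCm]
      refine integral_congr_ae (Filter.Eventually.of_forall fun ω => ?_)
      by_cases h : ω ∈ openConn t o
      · simp [Set.indicator_of_mem h]
      · simp [Set.indicator_of_notMem h]
    rw [this, h10, ← integral_neg]
    refine integral_congr_ae (Filter.Eventually.of_forall fun ω => ?_)
    simp only [hR]; ring
  have i2 : ∫ ω in D, (fun W => - R W) (openCluster ω s) ∂μ = - μ.real (D ∩ openConn t o) := by
    have : μ.real (D ∩ openConn t o) =
        ∫ ω in D, (openConn t o).indicator (fun _ => (1 : ℝ)) ω ∂μ := by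
      rw [Set.inter_comm, ← integral_indicator_one (hCm.inter hDm), Set.inter_comm, ← Set.indicator_indicator,
        integral_indicator hDm]
      rfl
    rw [this, h10', ← integral_neg]
  rw [i1, i2] at key
  have eq : ∫ ω, D.indicator (fun _ => (1 : ℝ)) (insert e ω) *
        ((F (openCluster (insert e ω) s) - F (openCluster (ω \ {e}) s)) *
          (R (openCluster (ω \ {e}) s) - R (openCluster (insert e ω) s))) ∂μ =
      ∫ ω, D.indicator (fun _ => (1 : ℝ)) (insert e ω) *
        ((F (openCluster (insert e ω) s) - F (openCluster (ω \ {e}) s)) *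
          ((fun W => - R W) (openCluster (insert e ω) s) - (fun W => - R W) (openCluster (ω \ {e}) s))) ∂μ := by
    refine integral_congr_ae (Filter.Eventually.of_forall fun ω => ?_)
    simp only; ring
  rw [eq]
  linarith [key]

/-- **BHK's display (10), functional form**: on `D = {s ↮ t}`, conditioning on `C_s` turns an arbitrary function `G(C_t)` of the
other cluster into `Ψ_G(C_s)`, `Ψ_G(W) = ∫ G(C_t(η off the pairs meeting W)) dμ(η)` (fresh variables off `W̄`; domain Markov property):
`∫_D F(C_s)·G(C_t) dμ = ∫_D F(C_s)·Ψ_G(C_s) dμ`. [cite: VandenbergHaggstromKahn2005, display (10) (p. 7)] -/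
theorem setIntegral_mul_clusterFn_eq_condexp (w : Sym2 V → unitInterval) (s t : V) (F G : Set V → ℝ) :
    ∫ ω in {ω : BondConfig V | ¬ (openGraph ω).Reachable s t},
        F (openCluster ω s) * G (openCluster ω t) ∂(prodBernoulli w) =
      ∫ ω in {ω : BondConfig V | ¬ (openGraph ω).Reachable s t},
        F (openCluster ω s) *
          (∫ η, G (openCluster (η \ {f | ∃ u ∈ openCluster ω s, u ∈ f}) t) ∂(prodBernoulli w)) ∂(prodBernoulli w) := by
  set w' : Sym2 V → ℝ := fun f => (w f : ℝ) with hw'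
  have hm : ∑ ω, weight w' ω = 1 := by
    have h1 := integral_prodBernoulli_eq_sum w fun _ => (1 : ℝ)
    simp only [integral_const, probReal_univ, smul_eq_mul, mul_one] at h1
    exact h1.symm
  set vs : Set (Sym2 V) → Set V := fun C => {a : V | a = s ∨ ∃ e' ∈ C, a ∈ e'} with hvs
  have hvsC : ∀ ζ : BondConfig V, vs (openEdgeCluster ζ s) = openCluster ζ s := fun ζ => by
    rw [KNPreFKG.openCluster_eq_setOf_openEdgeCluster]
  set vt : Set (Sym2 V) → Set V := fun C => {a : V | a = t ∨ ∃ e' ∈ C, a ∈ e'} with hvt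
  have hvtC : ∀ ζ : BondConfig V, vt (openEdgeCluster ζ t) = openCluster ζ t := fun ζ => by
    rw [KNPreFKG.openCluster_eq_setOf_openEdgeCluster]
  set H : Set (Sym2 V) → Set (Sym2 V) → ℝ := fun Cs Ct => F (vs Cs) * G (vt Ct) with hH
  have key := sum_cond_cluster w' hm s t H (D := {ω : Set (Sym2 V) | ¬ (openGraph ω).Reachable s t}) fun ω => Iff.rfl
  have hA : ∀ ω : BondConfig V, {e : Sym2 V | ∃ v ∈ e, v = s ∨ ∃ e' ∈ openEdgeCluster ω s, v ∈ e'} =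
      {f | ∃ u ∈ openCluster ω s, u ∈ f} := by
    intro ω
    ext f
    rw [← hvsC]
    simp only [hvs, Set.mem_setOf_eq]
    constructor
    · rintro ⟨v, hv, h⟩; exact ⟨v, h, hv⟩
    · rintro ⟨u, h, hu⟩; exact ⟨u, hu, h⟩
  rw [setIntegral_eq_sum_weight, setIntegral_eq_sum_weight]
  have hl : ∀ ω : BondConfig V, F (openCluster ω s) * G (openCluster ω t) =
      H (openEdgeCluster ω s) (openEdgeCluster ω t) := by
    intro ω
    simp only [hH, hvsC, hvtC]
  have hr : ∀ ω : BondConfig V,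
      F (openCluster ω s) * (∫ η, G (openCluster (η \ {f | ∃ u ∈ openCluster ω s, u ∈ f}) t) ∂(prodBernoulli w)) =
        ∑ η, weight w' η * H (openEdgeCluster ω s)
          (openEdgeCluster (η \ {e | ∃ v ∈ e, v = s ∨ ∃ e' ∈ openEdgeCluster ω s, v ∈ e'}) t) := by
    intro ω
    rw [hA ω, integral_prodBernoulli_eq_sum, Finset.mul_sum]
    refine Finset.sum_congr rfl fun η _ => ?_
    simp only [hH, hvsC, hvtC]
    ring
  simp_rw [hl, hr]
  exact key

/-- The conditional expectation `Ψ_G(W) = ∫ G(C_t(η off the pairs meeting W)) dμ(η)` of an increasing `G` is antitone in `W`. [folklore] -/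
theorem condexp_clusterFn_antitone (w : Sym2 V → unitInterval) (t : V) (G : Set V → ℝ) (hG : Monotone G) :
    Antitone fun W : Set V => ∫ η, G (openCluster (η \ {f | ∃ u ∈ W, u ∈ f}) t) ∂(prodBernoulli w) := by
  intro W W' hWW'
  simp only [integral_prodBernoulli_eq_sum]
  refine Finset.sum_le_sum fun η _ => mul_le_mul_of_nonneg_left (hG fun y hy => ?_)
    (weight_nonneg (fun f => (w f).2.1) (fun f => (w f).2.2) η)
  refine hy.mono (openGraph_le (Set.sdiff_subset_sdiff_right ?_))
  rintro f ⟨u, hu, huf⟩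
  exact ⟨u, hWW' hu, huf⟩

/-- **Row M2-R9, functional form: quantitative BHK Thm 1.4 with the Glauber floor.**  `D = {s ↮ t}`, `F, G` increasing functions of
(the vertex sets of) `C_s`, `C_t`, `Ψ_G(W) = ∫ G(C_t(η off the pairs meeting W)) dμ(η)` (antitone), `e` any pair:
  `μ(D)·w_e(1−w_e)·∫ 1_D(ω∪e)·(F(C_s(ω∪e)) − F(C_s(ω∖e)))·(Ψ_G(C_s(ω∖e)) − Ψ_G(C_s(ω∪e))) dμ ≤ (∫_D F(C_s))(∫_D G(C_t)) − μ(D)·∫_D F(C_s)G(C_t)`,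
i.e. `−Cov_ν(F(C_s), G(C_t)) = Cov_ν(F(C_s), −Ψ_G(C_s)) ≥ E_ν[Cov_ν(F, −Ψ_G | ω off e)] ≥ 0`, `ν = μ(·|s↮t)`; BHK's Thm 1.4 is `≥ 0`.
[cite: VandenbergHaggstromKahn2005, Thm. 1.3 (p. 6), Thm. 1.4 and display (10) (p. 7)] -/
theorem twoCluster_negCov_ge_glauberTerm (w : Sym2 V → unitInterval) (s t : V) (e : Sym2 V) (F G : Set V → ℝ)
    (hF : Monotone F) (hG : Monotone G) :
    (prodBernoulli w).real {ω : BondConfig V | ¬ (openGraph ω).Reachable s t} *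
        ((w e : ℝ) * (1 - w e) *
          ∫ ω, ({ω : BondConfig V | ¬ (openGraph ω).Reachable s t}).indicator (fun _ => (1 : ℝ)) (insert e ω) *
            ((F (openCluster (insert e ω) s) - F (openCluster (ω \ {e}) s)) *
              ((∫ η, G (openCluster (η \ {f | ∃ u ∈ openCluster (ω \ {e}) s, u ∈ f}) t) ∂(prodBernoulli w)) -
                (∫ η, G (openCluster (η \ {f | ∃ u ∈ openCluster (insert e ω) s, u ∈ f}) t) ∂(prodBernoulli w))))
            ∂(prodBernoulli w)) ≤
      (∫ ω in {ω : BondConfig V | ¬ (openGraph ω).Reachable s t}, F (openCluster ω s) ∂(prodBernoulli w)) *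
          (∫ ω in {ω : BondConfig V | ¬ (openGraph ω).Reachable s t}, G (openCluster ω t) ∂(prodBernoulli w)) -
        (prodBernoulli w).real {ω : BondConfig V | ¬ (openGraph ω).Reachable s t} *
          ∫ ω in {ω : BondConfig V | ¬ (openGraph ω).Reachable s t},
            F (openCluster ω s) * G (openCluster ω t) ∂(prodBernoulli w) := by
  set μ := prodBernoulli w with hμ
  set Ψ : Set V → ℝ := fun W => ∫ η, G (openCluster (η \ {f | ∃ u ∈ W, u ∈ f}) t) ∂μ with hΨ
  have hΨa : Antitone Ψ := condexp_clusterFn_antitone w t G hG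
  have hG' : Monotone fun W => - Ψ W := fun W W' h => neg_le_neg (hΨa h)
  have key := condCov_ge_glauberTerm w s {t} e F (fun W => - Ψ W) hF hG'
  have hDt : {ω : BondConfig V | ∀ x ∈ ({t} : Set V), ¬ (openGraph ω).Reachable s x} =
      {ω : BondConfig V | ¬ (openGraph ω).Reachable s t} := by
    ext ω; simp
  rw [hDt] at key
  set D : Set (BondConfig V) := {ω : BondConfig V | ¬ (openGraph ω).Reachable s t} with hD
  -- display (10)
  have h10 := setIntegral_mul_clusterFn_eq_condexp w s t F G
  have h10' := setIntegral_mul_clusterFn_eq_condexp w s t (fun _ => (1 : ℝ)) G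
  simp only [one_mul] at h10'
  have i1 : ∫ ω in D, F (openCluster ω s) * (fun W => - Ψ W) (openCluster ω s) ∂μ =
      - ∫ ω in D, F (openCluster ω s) * G (openCluster ω t) ∂μ := by
    rw [h10, ← integral_neg]
    refine integral_congr_ae (Filter.Eventually.of_forall fun ω => ?_)
    simp only [hΨ]; ring
  have i2 : ∫ ω in D, (fun W => - Ψ W) (openCluster ω s) ∂μ = - ∫ ω in D, G (openCluster ω t) ∂μ := by
    rw [h10', ← integral_neg]
  rw [i1, i2] at key
  have eq : ∫ ω, D.indicator (fun _ => (1 : ℝ)) (insert e ω) *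
        ((F (openCluster (insert e ω) s) - F (openCluster (ω \ {e}) s)) *
          (Ψ (openCluster (ω \ {e}) s) - Ψ (openCluster (insert e ω) s))) ∂μ =
      ∫ ω, D.indicator (fun _ => (1 : ℝ)) (insert e ω) *
        ((F (openCluster (insert e ω) s) - F (openCluster (ω \ {e}) s)) *
          ((fun W => - Ψ W) (openCluster (insert e ω) s) - (fun W => - Ψ W) (openCluster (ω \ {e}) s))) ∂μ := by
    refine integral_congr_ae (Filter.Eventually.of_forall fun ω => ?_)
    simp only; ring
  rw [eq]
  linarith [key]

end QuantBHK

end Summit.CriticalPhenomena.PercolationContinuityZ3.Theorems
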